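import Literature.MathematicalPhysics.QuantumLattice.HubbardOpenBoxWitnessPlanes
import Literature.MathematicalPhysics.QuantumLattice.HubbardNNNHoppingEnergyDensityConvex
import Literature.MathematicalPhysics.QuantumLattice.HubbardLiebTwoHoppings
import Literature.MathematicalPhysics.QuantumChemistry.SubsystemSectorConstraints
import HarnessLib

/-!
# Thermodynamic-limit energy-density UPPER bounds from an ARBITRARY open-cluster witness
# (no particle-number hypothesis): sector decomposition + convexity in the density

HONEST FRAMING: first certified bounds; not a superconductivity verdict. This file is a THEOREM about
the `t–t'` Hubbard model of the tree and certifies no number.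

`ThermodynamicLimit.energyDensityTT'_le_re_expect_openBox` (HubbardNNNHoppingOpenClusters) transports
the mean energy of a UNIT `N`-PARTICLE vector `φ` of the open `a × b` cluster to the thermodynamic
limit: `e(t,t',U,N/(ab)) ≤ Re⟨φ, H_open φ⟩/(ab)` (`U ≥ 0`). Numerical witnesses that BREAK particle-number
conservation — pairing-field ("sourced") MPS, grand-canonical DMRG states, BCS-type ansätze — are not
`N`-particle vectors. This file removes the hypothesis: for EVERY unit vector `ψ` of the cluster Fock
space with no component in the completely filled sector,

  `e(t, t', U, ⟨ψ, N̂ ψ⟩/(ab)) ≤ Re⟨ψ, H_open(a × b; t, t', U) ψ⟩/(ab)`      (`U ≥ 0`),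

i.e. the plain-Hamiltonian energy of the witness bounds the ground-state energy density at the
witness's MEAN density. Proof (folklore assembly of three tree facts): decompose `ψ = Σ_{(α,β)} P_{αβ} ψ`
into its `(N↑, N↓)` sectors (`sum_sum_sectorProj_eq`); `H_open` and `N̂` are block diagonal
(`PreservesSectors`), so `⟨ψ,Hψ⟩ = Σ ⟨P ψ, H P ψ⟩` and `⟨ψ,N̂ψ⟩ = Σ (α+β)‖Pψ‖²`; each sector component is
an `(α+β)`-particle vector, so the open-box bound gives `(ab)·e((α+β)/(ab))·‖Pψ‖² ≤ Re⟨Pψ, H Pψ⟩`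
(`α + β < 2ab` for every sector but the filled one, whose weight is zero by hypothesis); finally
`n ↦ e(t,t',U,n)` is CONVEX on `[0,2)` (`convexOn_energyDensityTT'`, Ruelle (1969) §3.3), and Jensen's
inequality with the weights `‖P_{αβ}ψ‖²` (which sum to `‖ψ‖² = 1`) closes the chain. The ensemble form
`Σ_N x_N E₀(N) ≤ ⟨ψ,Hψ⟩` of the first two steps is Verstichel et al. (2010) eq. (12) / Lieb (1989)
(work sector by sector); the density-convexity step is Ruelle (1969) §3.3–3.4.

Also: the homogeneous per-sector form, the mean-density identity, and the four-PLANE corollary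
(`…_witness_planes_of_sectorProj_top_eq_zero`, the mixed-sector twin of
`energyDensityTT'_le_of_openBox_witness_planes`): one witness with certified pieces
`Re⟨ψ,H(1,0,0)ψ⟩ ≤ E_K`, `Re⟨ψ,H(0,±1,0)ψ⟩ ≤ E_P / E_M`, `Re⟨ψ,H(0,0,1)ψ⟩ ≤ E_D` caps the whole
`(t', U ≥ 0)` plane at its mean density.

NOT here: witnesses WITH a filled-sector component (removable by one more step with the one-sided
Lipschitz bound `energyDensityTT'_le_add`; not needed by any certificate format on the books, whose
states carry explicit sector labels or a certified overlap with the filled configuration); tori;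
`U < 0`.
-/

noncomputable section

open Matrix Finset
open scoped ComplexOrder BigOperators

namespace Literature.MathematicalPhysics.QuantumLattice

namespace ThermodynamicLimit

open Literature.MathematicalPhysics.QuantumChemistry

variable {a b : ℕ}

/-- The open-cluster `t–t'` Hamiltonian is block diagonal in the `(N↑, N↓)` sectors (it is
`hamiltonian (rectBoxGraph a b) t U + hamiltonian (rectBoxDiagGraph a b) t' 0`, both sector
preserving). Lieb, PRL 62 (1989) 1201, Remark (2)(i). [cite: LiebPRL1989, Remark (2)] -/
theorem preservesSectors_hubbardOpenBoxTT' (a b : ℕ) (t t' U : ℝ) :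
    PreservesSectors (hubbardOpenBoxTT' a b t t' U) := by
  unfold hubbardOpenBoxTT'
  exact LiebTwoHoppings.preservesSectors_hamiltonian₂ _ _ t t' U

/-- The total number operator is block diagonal in the `(N↑, N↓)` sectors. [folklore] -/
private theorem preservesSectors_totalNumber {Λ : Type*} [LinearOrder Λ] [Fintype Λ] :
    PreservesSectors (totalNumber : Matrix (Finset (Orb Λ)) (Finset (Orb Λ)) ℂ) := by
  rw [LiebThm1.totalNumber_eq_diagonal]
  exact PreservesSectors.diagonal _

/-- On a vector of the sector `(α, β)` the total number operator acts as the scalar `α + β`.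
[folklore] -/
private theorem totalNumber_mulVec_of_isInSector {Λ : Type*} [LinearOrder Λ] [Fintype Λ] {α β : ℕ}
    {χ : Fock (Orb Λ)} (hχ : IsInSector α β χ) :
    totalNumber *ᵥ χ = ((α + β : ℕ) : ℂ) • χ := by
  funext s
  rw [LiebTwo.totalNumber_mulVec, Pi.smul_apply, smul_eq_mul]
  by_cases hs : (upPart s).card = α ∧ (downPart s).card = β
  · rw [card_eq_upPart_add_downPart s, hs.1, hs.2]
  · rw [hχ s hs, mul_zero, mul_zero]

/-- `Re⟨χ, N̂ χ⟩ = (α + β)·‖χ‖²` on the sector `(α, β)`. [folklore] -/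
private theorem re_star_dotProduct_totalNumber_mulVec_of_isInSector {Λ : Type*} [LinearOrder Λ] [Fintype Λ]
    {α β : ℕ} {χ : Fock (Orb Λ)} (hχ : IsInSector α β χ) :
    (star χ ⬝ᵥ (totalNumber *ᵥ χ)).re = ((α + β : ℕ) : ℝ) * (star χ ⬝ᵥ χ).re := by
  rw [totalNumber_mulVec_of_isInSector hχ, dotProduct_smul, smul_eq_mul, ← Complex.ofReal_natCast,
    Complex.re_ofReal_mul]

/-- **Homogeneous per-sector open-box bound.** For `U ≥ 0` and an `N`-particle vector `χ` of the open
`a × b` cluster with `N < 2ab` (no normalisation): `(ab) · e(t,t',U,N/(ab)) · ‖χ‖² ≤ Re⟨χ, H_open χ⟩`.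
(`energyDensityTT'_le_openBox` × the homogeneous Rayleigh principle `groundEnergy_mul_norm_le`.)
[cite: Ruelle1969, §3.3] -/
theorem energyDensityTT'_mul_norm_le_re_expect_openBox (t t' : ℝ) {U : ℝ} (hU : 0 ≤ U)
    (ha : 1 ≤ a) (hb : 1 ≤ b) {N : ℕ} (hN : N < 2 * (a * b)) {χ : Fock (Orb (Fin a ×ₗ Fin b))}
    (hχ : IsNParticle N χ) :
    ((a : ℝ) * (b : ℝ)) * energyDensityTT' t t' U ((N : ℝ) / ((a : ℝ) * (b : ℝ))) *
        (star χ ⬝ᵥ χ).re ≤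
      (star χ ⬝ᵥ (hubbardOpenBoxTT' a b t t' U *ᵥ χ)).re := by
  have hab : (0 : ℝ) < (a : ℝ) * (b : ℝ) := by
    have ha' : (0 : ℝ) < a := by exact_mod_cast ha
    have hb' : (0 : ℝ) < b := by exact_mod_cast hb
    positivity
  have hTL := energyDensityTT'_le_openBox t t' hU ha hb hN
  have hnorm : 0 ≤ (star χ ⬝ᵥ χ).re := (Complex.nonneg_iff.1 (dotProduct_star_self_nonneg χ)).1
  have hRR := LiebThm1.groundEnergy_mul_norm_le (hubbardOpenBoxTT' a b t t' U) hχ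
  rw [expect] at hRR
  have h1 : ((a : ℝ) * (b : ℝ)) * energyDensityTT' t t' U ((N : ℝ) / ((a : ℝ) * (b : ℝ))) ≤
      groundEnergy (hubbardOpenBoxTT' a b t t' U) N := by
    rw [le_div_iff₀ hab] at hTL
    linarith
  exact (mul_le_mul_of_nonneg_right h1 hnorm).trans hRR

/-- For sector-labelled witnesses: a vector of the sector `(α, β) ≠ (ab, ab)` has no component in the
completely filled sector (Lieb (1989): one works in a sector of fixed `N↑`, `N↓`).
[cite: LiebPRL1989, proof of Theorem 1] -/
theorem sectorProj_top_eq_zero_of_isInSector {α β : ℕ} {ψ : Fock (Orb (Fin a ×ₗ Fin b))}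
    (hψ : IsInSector α β ψ) (hne : (α, β) ≠ (a * b, a * b)) :
    sectorProj (a * b) (a * b) ψ = 0 := by
  funext s
  rw [sectorProj_apply, Pi.zero_apply]
  split_ifs with hs
  · exact hψ s fun h => hne (Prod.ext (h.1.symm.trans hs.1) (h.2.symm.trans hs.2))
  · rfl

/-- **Thermodynamic-limit energy-density upper bound from an ARBITRARY open-cluster witness.**
For `U ≥ 0`, `1 ≤ a`, `1 ≤ b` and EVERY unit vector `ψ` of the Fock space of the open `a × b` cluster
with no component in the completely filled sector (`P_{(ab,ab)} ψ = 0`; no particle-number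
hypothesis — `ψ` may superpose sectors, e.g. a pairing-field / grand-canonical MPS with the filled
amplitude projected out):
`e(t, t', U, ⟨ψ, N̂ ψ⟩/(ab)) ≤ Re⟨ψ, H_open(a × b; t, t', U) ψ⟩/(ab)` — the plain-Hamiltonian mean energy
of the witness bounds the ground-state energy density at the witness's MEAN density. Sector
decomposition (Lieb 1989; Verstichel et al. (2010) eq. (12): `Σ_N x_N E₀(N) ≤ E(ψ)`), the open-box
bound sector by sector, and Jensen's inequality for the convex `n ↦ e(t,t',U,n)` (Ruelle (1969) §3.3).
[cite: Ruelle1969, §3.3] -/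
theorem energyDensityTT'_le_re_expect_openBox_of_sectorProj_top_eq_zero (t t' : ℝ) {U : ℝ}
    (hU : 0 ≤ U) (ha : 1 ≤ a) (hb : 1 ≤ b) {ψ : Fock (Orb (Fin a ×ₗ Fin b))}
    (hψ1 : star ψ ⬝ᵥ ψ = 1) (htop : sectorProj (a * b) (a * b) ψ = 0) :
    energyDensityTT' t t' U ((star ψ ⬝ᵥ (totalNumber *ᵥ ψ)).re / ((a : ℝ) * (b : ℝ))) ≤
      (star ψ ⬝ᵥ (hubbardOpenBoxTT' a b t t' U *ᵥ ψ)).re / ((a : ℝ) * (b : ℝ)) := by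
  classical
  have hab : (0 : ℝ) < (a : ℝ) * (b : ℝ) := by
    have ha' : (0 : ℝ) < a := by exact_mod_cast ha
    have hb' : (0 : ℝ) < b := by exact_mod_cast hb
    positivity
  -- the sector index set
  set V : ℕ := Fintype.card (Fin a ×ₗ Fin b) with hVdef
  have hV : V = a * b := by
    rw [hVdef]
    show Fintype.card (Lex (Fin a × Fin b)) = a * b
    rw [Fintype.card_lex, Fintype.card_prod, Fintype.card_fin, Fintype.card_fin]
  set R : Finset ℕ := Finset.range (V + 1) with hR
  set S : Finset (ℕ × ℕ) := R ×ˢ R with hS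
  have htopS : (V, V) ∈ S := by
    simp only [hS, hR, Finset.mem_product, Finset.mem_range]
    omega
  have hPtop : sectorProj V V ψ = 0 := by rw [hV]; exact htop
  -- (A) the energy splits over the sectors
  have hE : (star ψ ⬝ᵥ (hubbardOpenBoxTT' a b t t' U *ᵥ ψ)).re =
      ∑ q ∈ S, (star (sectorProj q.1 q.2 ψ) ⬝ᵥ
        (hubbardOpenBoxTT' a b t t' U *ᵥ sectorProj q.1 q.2 ψ)).re := by
    rw [star_dotProduct_mulVec_eq_sum_sum_sectorProj (fun α β χ hχ =>
      PreservesSectors.isInSector_mulVec (preservesSectors_hubbardOpenBoxTT' a b t t' U) hχ) ψ,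
      Complex.re_sum, hS, Finset.sum_product]
    exact Finset.sum_congr rfl fun α _ => by rw [Complex.re_sum]
  -- (B) the mean particle number splits over the sectors
  have hN : (star ψ ⬝ᵥ (totalNumber *ᵥ ψ)).re =
      ∑ q ∈ S, ((q.1 + q.2 : ℕ) : ℝ) * (star (sectorProj q.1 q.2 ψ) ⬝ᵥ sectorProj q.1 q.2 ψ).re := by
    rw [star_dotProduct_mulVec_eq_sum_sum_sectorProj (fun α β χ hχ =>
      PreservesSectors.isInSector_mulVec preservesSectors_totalNumber hχ) ψ,
      Complex.re_sum, hS, Finset.sum_product]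
    refine Finset.sum_congr rfl fun α _ => ?_
    rw [Complex.re_sum]
    exact Finset.sum_congr rfl fun β _ =>
      re_star_dotProduct_totalNumber_mulVec_of_isInSector (isInSector_sectorProj α β ψ)
  -- (C) the sector weights sum to one
  have hW : ∑ q ∈ S, (star (sectorProj q.1 q.2 ψ) ⬝ᵥ sectorProj q.1 q.2 ψ).re = 1 := by
    have h := congrArg Complex.re (star_dotProduct_self_eq_sum_sum_sectorProj ψ)
    rw [hψ1, Complex.one_re, Complex.re_sum] at h
    rw [hS, Finset.sum_product, h]
    exact Finset.sum_congr rfl fun α _ => by rw [Complex.re_sum]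
  -- remove the (empty) filled sector
  set S' : Finset (ℕ × ℕ) := S.erase (V, V) with hS'
  have hW' : ∑ q ∈ S', (star (sectorProj q.1 q.2 ψ) ⬝ᵥ sectorProj q.1 q.2 ψ).re = 1 := by
    rw [← hW, ← Finset.add_sum_erase S _ htopS]
    simp only [hS', hPtop, dotProduct_zero, Complex.zero_re, zero_add]
  have hE' : ∑ q ∈ S', (star (sectorProj q.1 q.2 ψ) ⬝ᵥ
        (hubbardOpenBoxTT' a b t t' U *ᵥ sectorProj q.1 q.2 ψ)).re =
      ∑ q ∈ S, (star (sectorProj q.1 q.2 ψ) ⬝ᵥ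
        (hubbardOpenBoxTT' a b t t' U *ᵥ sectorProj q.1 q.2 ψ)).re := by
    rw [← Finset.add_sum_erase S _ htopS]
    simp only [hS', hPtop, mulVec_zero, dotProduct_zero, Complex.zero_re, zero_add]
  have hN' : ∑ q ∈ S', ((q.1 + q.2 : ℕ) : ℝ) * (star (sectorProj q.1 q.2 ψ) ⬝ᵥ sectorProj q.1 q.2 ψ).re =
      ∑ q ∈ S, ((q.1 + q.2 : ℕ) : ℝ) * (star (sectorProj q.1 q.2 ψ) ⬝ᵥ sectorProj q.1 q.2 ψ).re := by
    rw [← Finset.add_sum_erase S _ htopS]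
    simp only [hS', hPtop, dotProduct_zero, Complex.zero_re, mul_zero, zero_add]
  -- every remaining sector has fewer than `2ab` particles
  have hlt : ∀ q ∈ S', q.1 + q.2 < 2 * (a * b) := by
    intro q hq
    simp only [hS', hS, hR, Finset.mem_erase, Finset.mem_product, Finset.mem_range, Ne,
      Prod.ext_iff] at hq
    rw [← hV]
    omega
  have hw0 : ∀ q ∈ S', 0 ≤ (star (sectorProj q.1 q.2 ψ) ⬝ᵥ sectorProj q.1 q.2 ψ).re :=
    fun q _ => (Complex.nonneg_iff.1 (dotProduct_star_self_nonneg _)).1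
  have hxmem : ∀ q ∈ S', ((q.1 + q.2 : ℕ) : ℝ) / ((a : ℝ) * (b : ℝ)) ∈ Set.Ico (0 : ℝ) 2 := by
    intro q hq
    refine ⟨by positivity, ?_⟩
    rw [div_lt_iff₀ hab]
    exact_mod_cast hlt q hq
  -- Jensen for the convex `n ↦ e(t,t',U,n)` with the sector weights
  have hJ := (convexOn_energyDensityTT' t t' hU).map_sum_le hw0 hW' hxmem
  have hmean : ∑ q ∈ S', (star (sectorProj q.1 q.2 ψ) ⬝ᵥ sectorProj q.1 q.2 ψ).re •
      (((q.1 + q.2 : ℕ) : ℝ) / ((a : ℝ) * (b : ℝ))) =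
      (star ψ ⬝ᵥ (totalNumber *ᵥ ψ)).re / ((a : ℝ) * (b : ℝ)) := by
    rw [hN, ← hN', Finset.sum_div]
    exact Finset.sum_congr rfl fun q _ => by rw [smul_eq_mul]; ring
  rw [hmean] at hJ
  refine hJ.trans ?_
  -- and the open-box bound sector by sector
  rw [hE, ← hE', le_div_iff₀ hab, Finset.sum_mul]
  refine Finset.sum_le_sum fun q hq => ?_
  have hsec := energyDensityTT'_mul_norm_le_re_expect_openBox t t' hU ha hb (hlt q hq)
    ((isInSector_sectorProj q.1 q.2 ψ).isNParticle)
  rw [smul_eq_mul]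
  calc (star (sectorProj q.1 q.2 ψ) ⬝ᵥ sectorProj q.1 q.2 ψ).re *
        energyDensityTT' t t' U (((q.1 + q.2 : ℕ) : ℝ) / ((a : ℝ) * (b : ℝ))) * ((a : ℝ) * (b : ℝ))
      = ((a : ℝ) * (b : ℝ)) * energyDensityTT' t t' U (((q.1 + q.2 : ℕ) : ℝ) / ((a : ℝ) * (b : ℝ))) *
        (star (sectorProj q.1 q.2 ψ) ⬝ᵥ sectorProj q.1 q.2 ψ).re := by ring
    _ ≤ _ := hsec

/-- An `N`-particle vector with `N < 2ab` has no component in the completely filled sector (so the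
mixed-sector bound below contains `energyDensityTT'_le_re_expect_openBox` as the special case of a
number-definite witness); Lieb (1989), proof of Thm 1 (sectors of fixed particle numbers).
[cite: LiebPRL1989, proof of Theorem 1] -/
theorem sectorProj_top_eq_zero_of_isNParticle {N : ℕ} (hN : N < 2 * (a * b))
    {ψ : Fock (Orb (Fin a ×ₗ Fin b))} (hψ : IsNParticle N ψ) :
    sectorProj (a * b) (a * b) ψ = 0 := by
  funext s
  rw [sectorProj_apply, Pi.zero_apply]
  split_ifs with hs
  · refine hψ s fun h => ?_
    have hcard := card_eq_upPart_add_downPart s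
    rw [hs.1, hs.2, h] at hcard
    omega
  · rfl

/-- **Four certified PLANES of one ARBITRARY witness cap the whole `(t', U ≥ 0)` plane at its mean
density** — the mixed-sector twin of `energyDensityTT'_le_of_openBox_witness_planes`: a unit vector
`ψ` of the open `a × b` cluster with no filled-sector component, mean particle number
`ν = Re⟨ψ, N̂ ψ⟩` and certified pieces `Re⟨ψ,H_open(1,0,0)ψ⟩ ≤ E_K`, `Re⟨ψ,H_open(0,1,0)ψ⟩ ≤ E_P`,
`Re⟨ψ,H_open(0,−1,0)ψ⟩ ≤ E_M`, `Re⟨ψ,H_open(0,0,1)ψ⟩ ≤ E_D` gives, for every real `t'` and every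
`U ≥ 0`, `e(1, t', U, ν/(ab)) ≤ (E_K + max (t'·E_P) (−t'·E_M) + U·E_D)/(ab)` (`H_open` is affine in
`(t,t',U)`: `re_expect_hubbardOpenBoxTT'_eq`). [cite: Ruelle1969, §3.3] -/
theorem energyDensityTT'_le_of_openBox_witness_planes_of_sectorProj_top_eq_zero {U : ℝ} (hU : 0 ≤ U)
    (ha : 1 ≤ a) (hb : 1 ≤ b) {ψ : Fock (Orb (Fin a ×ₗ Fin b))} (hψ1 : star ψ ⬝ᵥ ψ = 1)
    (htop : sectorProj (a * b) (a * b) ψ = 0) {EK EP EM ED : ℝ}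
    (hK : (star ψ ⬝ᵥ (hubbardOpenBoxTT' a b 1 0 0 *ᵥ ψ)).re ≤ EK)
    (hP : (star ψ ⬝ᵥ (hubbardOpenBoxTT' a b 0 1 0 *ᵥ ψ)).re ≤ EP)
    (hM : (star ψ ⬝ᵥ (hubbardOpenBoxTT' a b 0 (-1) 0 *ᵥ ψ)).re ≤ EM)
    (hD : (star ψ ⬝ᵥ (hubbardOpenBoxTT' a b 0 0 1 *ᵥ ψ)).re ≤ ED) (t' : ℝ) :
    energyDensityTT' 1 t' U ((star ψ ⬝ᵥ (totalNumber *ᵥ ψ)).re / ((a : ℝ) * (b : ℝ))) ≤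
      (EK + max (t' * EP) (-t' * EM) + U * ED) / ((a : ℝ) * (b : ℝ)) := by
  refine (energyDensityTT'_le_re_expect_openBox_of_sectorProj_top_eq_zero 1 t' hU ha hb hψ1 htop).trans ?_
  have hab : (0 : ℝ) < (a : ℝ) * (b : ℝ) := by
    have ha' : (0 : ℝ) < a := by exact_mod_cast ha
    have hb' : (0 : ℝ) < b := by exact_mod_cast hb
    positivity
  refine div_le_div_of_nonneg_right ?_ hab.le
  rw [re_expect_hubbardOpenBoxTT'_eq a b t' U ψ]
  set X := (star ψ ⬝ᵥ (hubbardOpenBoxTT' a b 0 1 0 *ᵥ ψ)).re with hX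
  have hnegX : -X ≤ EM := by
    have h := hM
    rw [hubbardOpenBoxTT'_zero_neg_one_zero, neg_mulVec, dotProduct_neg, Complex.neg_re] at h
    exact h
  have hdiag : t' * X ≤ max (t' * EP) (-t' * EM) := by
    rcases le_or_gt 0 t' with ht | ht
    · exact (mul_le_mul_of_nonneg_left hP ht).trans (le_max_left _ _)
    · have : t' * X = (-t') * (-X) := by ring
      rw [this]
      exact (mul_le_mul_of_nonneg_left hnegX (by linarith)).trans (le_max_right _ _)
  have hdocc : U * (star ψ ⬝ᵥ (hubbardOpenBoxTT' a b 0 0 1 *ᵥ ψ)).re ≤ U * ED :=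
    mul_le_mul_of_nonneg_left hD hU
  linarith

/-- **Mean-density form at a prescribed rational.** The same bound stated at a density `ν/(ab)`
named by the certificate: if the witness's mean particle number is certified EXACTLY,
`Re⟨ψ, N̂ ψ⟩ = ν` (a rational for an integer tensor-network state), then
`e(t,t',U, ν/(ab)) ≤ Re⟨ψ, H_open ψ⟩/(ab)` (`U ≥ 0`). [cite: Ruelle1969, §3.3] -/
theorem energyDensityTT'_le_re_expect_openBox_of_meanNumber_eq (t t' : ℝ) {U : ℝ} (hU : 0 ≤ U)
    (ha : 1 ≤ a) (hb : 1 ≤ b) {ψ : Fock (Orb (Fin a ×ₗ Fin b))} (hψ1 : star ψ ⬝ᵥ ψ = 1)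
    (htop : sectorProj (a * b) (a * b) ψ = 0) {ν : ℝ} (hν : (star ψ ⬝ᵥ (totalNumber *ᵥ ψ)).re = ν) :
    energyDensityTT' t t' U (ν / ((a : ℝ) * (b : ℝ))) ≤
      (star ψ ⬝ᵥ (hubbardOpenBoxTT' a b t t' U *ᵥ ψ)).re / ((a : ℝ) * (b : ℝ)) := by
  rw [← hν]
  exact energyDensityTT'_le_re_expect_openBox_of_sectorProj_top_eq_zero t t' hU ha hb hψ1 htop

/-- **Homogeneous (unnormalised) form** — the shape an integer/dyadic tensor-network certificate
discharges directly: for a NONZERO vector `ψ` of the open cluster with no filled-sector component, whose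
mean particle number is certified as an exact multiple of its norm, `Re⟨ψ, N̂ ψ⟩ = ν·⟨ψ,ψ⟩`, one has
`(ab) · e(t,t',U, ν/(ab)) · ⟨ψ,ψ⟩ ≤ Re⟨ψ, H_open ψ⟩` (`U ≥ 0`). Normalise `ψ/‖ψ‖` and apply
`energyDensityTT'_le_re_expect_openBox_of_meanNumber_eq`. [cite: Ruelle1969, §3.3] -/
theorem energyDensityTT'_mul_norm_le_re_expect_openBox_of_sectorProj_top_eq_zero (t t' : ℝ) {U : ℝ}
    (hU : 0 ≤ U) (ha : 1 ≤ a) (hb : 1 ≤ b) {ψ : Fock (Orb (Fin a ×ₗ Fin b))} (hψ0 : ψ ≠ 0)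
    (htop : sectorProj (a * b) (a * b) ψ = 0) {ν : ℝ}
    (hν : (star ψ ⬝ᵥ (totalNumber *ᵥ ψ)).re = ν * (star ψ ⬝ᵥ ψ).re) :
    ((a : ℝ) * (b : ℝ)) * energyDensityTT' t t' U (ν / ((a : ℝ) * (b : ℝ))) * (star ψ ⬝ᵥ ψ).re ≤
      (star ψ ⬝ᵥ (hubbardOpenBoxTT' a b t t' U *ᵥ ψ)).re := by
  have hab : (0 : ℝ) < (a : ℝ) * (b : ℝ) := by
    have ha' : (0 : ℝ) < a := by exact_mod_cast ha
    have hb' : (0 : ℝ) < b := by exact_mod_cast hb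
    positivity
  have h1 : 0 < star ψ ⬝ᵥ ψ :=
    lt_of_le_of_ne (dotProduct_star_self_nonneg ψ) (Ne.symm (mt dotProduct_star_self_eq_zero.1 hψ0))
  have hpos : 0 < (star ψ ⬝ᵥ ψ).re := (Complex.pos_iff.1 h1).1
  have him : (star ψ ⬝ᵥ ψ).im = 0 := (Complex.pos_iff.1 h1).2.symm
  set r : ℝ := (star ψ ⬝ᵥ ψ).re with hr
  -- normalise
  set c : ℂ := (((Real.sqrt r)⁻¹ : ℝ) : ℂ) with hc
  have hcc : star c * c = ((r⁻¹ : ℝ) : ℂ) := by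
    rw [hc, Complex.star_def, Complex.conj_ofReal, ← Complex.ofReal_mul, ← mul_inv,
      Real.mul_self_sqrt hpos.le]
  have hψr : star ψ ⬝ᵥ ψ = (r : ℂ) := Complex.ext (by simp [hr]) (by simp [him])
  have hnorm : star (c • ψ) ⬝ᵥ (c • ψ) = 1 := by
    rw [star_smul, smul_dotProduct, dotProduct_smul, smul_smul, hcc, smul_eq_mul, hψr,
      ← Complex.ofReal_mul, inv_mul_cancel₀ hpos.ne', Complex.ofReal_one]
  have htop' : sectorProj (a * b) (a * b) (c • ψ) = 0 := by rw [sectorProj_smul, htop, smul_zero]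
  have hN' : (star (c • ψ) ⬝ᵥ (totalNumber *ᵥ (c • ψ))).re = ν := by
    rw [mulVec_smul, star_smul, smul_dotProduct, dotProduct_smul, smul_smul, hcc, smul_eq_mul,
      Complex.re_ofReal_mul, hν, ← mul_assoc, mul_comm (r⁻¹) ν, mul_assoc,
      inv_mul_cancel₀ hpos.ne', mul_one]
  have h := energyDensityTT'_le_re_expect_openBox_of_meanNumber_eq t t' hU ha hb hnorm htop' hN'
  rw [mulVec_smul, star_smul, smul_dotProduct, dotProduct_smul, smul_smul, hcc, smul_eq_mul,
    Complex.re_ofReal_mul, le_div_iff₀ hab] at h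
  -- h : e(ν/(ab)) * (ab) ≤ r⁻¹ * Re⟨ψ,Hψ⟩
  rw [le_inv_mul_iff₀ hpos] at h
  calc ((a : ℝ) * (b : ℝ)) * energyDensityTT' t t' U (ν / ((a : ℝ) * (b : ℝ))) * r
      = r * (energyDensityTT' t t' U (ν / ((a : ℝ) * (b : ℝ))) * ((a : ℝ) * (b : ℝ))) := by ring
    _ ≤ _ := h

/-- One-sided diagonal piece, `t' ≥ 0` (mixed-sector twin of
`energyDensityTT'_le_of_openBox_witness_plane_nonneg`): a unit witness with no filled-sector
component and pieces `E_K`, `E_P`, `E_D` gives `e(1, t', U, ⟨N̂⟩/(ab)) ≤ (E_K + t' E_P + U E_D)/(ab)`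
— the `(0,−1,0)` plane is not needed on this half-plane. [cite: Ruelle1969, §3.3] -/
theorem energyDensityTT'_le_of_openBox_witness_plane_nonneg_of_sectorProj_top_eq_zero {U : ℝ}
    (hU : 0 ≤ U) (ha : 1 ≤ a) (hb : 1 ≤ b) {ψ : Fock (Orb (Fin a ×ₗ Fin b))}
    (hψ1 : star ψ ⬝ᵥ ψ = 1) (htop : sectorProj (a * b) (a * b) ψ = 0) {EK EP ED : ℝ}
    (hK : (star ψ ⬝ᵥ (hubbardOpenBoxTT' a b 1 0 0 *ᵥ ψ)).re ≤ EK)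
    (hP : (star ψ ⬝ᵥ (hubbardOpenBoxTT' a b 0 1 0 *ᵥ ψ)).re ≤ EP)
    (hD : (star ψ ⬝ᵥ (hubbardOpenBoxTT' a b 0 0 1 *ᵥ ψ)).re ≤ ED) {t' : ℝ} (ht' : 0 ≤ t') :
    energyDensityTT' 1 t' U ((star ψ ⬝ᵥ (totalNumber *ᵥ ψ)).re / ((a : ℝ) * (b : ℝ))) ≤
      (EK + t' * EP + U * ED) / ((a : ℝ) * (b : ℝ)) := by
  refine (energyDensityTT'_le_re_expect_openBox_of_sectorProj_top_eq_zero 1 t' hU ha hb hψ1 htop).trans ?_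
  have hab : (0 : ℝ) < (a : ℝ) * (b : ℝ) := by
    have ha' : (0 : ℝ) < a := by exact_mod_cast ha
    have hb' : (0 : ℝ) < b := by exact_mod_cast hb
    positivity
  refine div_le_div_of_nonneg_right ?_ hab.le
  rw [re_expect_hubbardOpenBoxTT'_eq a b t' U ψ]
  have h1 : t' * (star ψ ⬝ᵥ (hubbardOpenBoxTT' a b 0 1 0 *ᵥ ψ)).re ≤ t' * EP :=
    mul_le_mul_of_nonneg_left hP ht'
  have h2 : U * (star ψ ⬝ᵥ (hubbardOpenBoxTT' a b 0 0 1 *ᵥ ψ)).re ≤ U * ED :=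
    mul_le_mul_of_nonneg_left hD hU
  linarith

/-- One-sided diagonal piece, `t' ≤ 0` (mixed-sector twin of
`energyDensityTT'_le_of_openBox_witness_plane_nonpos`): pieces `E_K`, `E_M`, `E_D` give
`e(1, t', U, ⟨N̂⟩/(ab)) ≤ (E_K + (−t') E_M + U E_D)/(ab)` — the cuprate half-plane `t' ≤ 0` needs only
the `(0,−1,0)` plane. [cite: Ruelle1969, §3.3] -/
theorem energyDensityTT'_le_of_openBox_witness_plane_nonpos_of_sectorProj_top_eq_zero {U : ℝ}
    (hU : 0 ≤ U) (ha : 1 ≤ a) (hb : 1 ≤ b) {ψ : Fock (Orb (Fin a ×ₗ Fin b))}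
    (hψ1 : star ψ ⬝ᵥ ψ = 1) (htop : sectorProj (a * b) (a * b) ψ = 0) {EK EM ED : ℝ}
    (hK : (star ψ ⬝ᵥ (hubbardOpenBoxTT' a b 1 0 0 *ᵥ ψ)).re ≤ EK)
    (hM : (star ψ ⬝ᵥ (hubbardOpenBoxTT' a b 0 (-1) 0 *ᵥ ψ)).re ≤ EM)
    (hD : (star ψ ⬝ᵥ (hubbardOpenBoxTT' a b 0 0 1 *ᵥ ψ)).re ≤ ED) {t' : ℝ} (ht' : t' ≤ 0) :
    energyDensityTT' 1 t' U ((star ψ ⬝ᵥ (totalNumber *ᵥ ψ)).re / ((a : ℝ) * (b : ℝ))) ≤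
      (EK + (-t') * EM + U * ED) / ((a : ℝ) * (b : ℝ)) := by
  refine (energyDensityTT'_le_re_expect_openBox_of_sectorProj_top_eq_zero 1 t' hU ha hb hψ1 htop).trans ?_
  have hab : (0 : ℝ) < (a : ℝ) * (b : ℝ) := by
    have ha' : (0 : ℝ) < a := by exact_mod_cast ha
    have hb' : (0 : ℝ) < b := by exact_mod_cast hb
    positivity
  refine div_le_div_of_nonneg_right ?_ hab.le
  rw [re_expect_hubbardOpenBoxTT'_eq a b t' U ψ]
  set X := (star ψ ⬝ᵥ (hubbardOpenBoxTT' a b 0 1 0 *ᵥ ψ)).re with hX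
  have hnegX : -X ≤ EM := by
    have h := hM
    rw [hubbardOpenBoxTT'_zero_neg_one_zero, neg_mulVec, dotProduct_neg, Complex.neg_re] at h
    exact h
  have h1 : t' * X ≤ (-t') * EM := by
    have : t' * X = (-t') * (-X) := by ring
    rw [this]; exact mul_le_mul_of_nonneg_left hnegX (by linarith)
  have h2 : U * (star ψ ⬝ᵥ (hubbardOpenBoxTT' a b 0 0 1 *ᵥ ψ)).re ≤ U * ED :=
    mul_le_mul_of_nonneg_left hD hU
  linarith

/-- **Cell cap from four planes of an ARBITRARY witness** (mixed-sector twin of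
`energyDensityTT'_le_cornerMax_of_openBox_witness_planes`): a unit witness with no filled-sector
component and pieces `E_K, E_P, E_M, E_D` caps EVERY point of a rectangle `[s₁, s₂] × [U₁, U₂]`
(`U₁ ≥ 0`) at its mean density by ONE number:
`e(1, t', U, ⟨N̂⟩/(ab)) ≤ (E_K + max (max (s₁E_P) (s₂E_P)) (max (−s₁E_M) (−s₂E_M)) + max (U₁E_D) (U₂E_D))/(ab)`.
[cite: Ruelle1969, §3.3] -/
theorem energyDensityTT'_le_cornerMax_of_openBox_witness_planes_of_sectorProj_top_eq_zero
    {U₁ U₂ s₁ s₂ : ℝ} (hU₁ : 0 ≤ U₁) (ha : 1 ≤ a) (hb : 1 ≤ b) {ψ : Fock (Orb (Fin a ×ₗ Fin b))}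
    (hψ1 : star ψ ⬝ᵥ ψ = 1) (htop : sectorProj (a * b) (a * b) ψ = 0) {EK EP EM ED : ℝ}
    (hK : (star ψ ⬝ᵥ (hubbardOpenBoxTT' a b 1 0 0 *ᵥ ψ)).re ≤ EK)
    (hP : (star ψ ⬝ᵥ (hubbardOpenBoxTT' a b 0 1 0 *ᵥ ψ)).re ≤ EP)
    (hM : (star ψ ⬝ᵥ (hubbardOpenBoxTT' a b 0 (-1) 0 *ᵥ ψ)).re ≤ EM)
    (hD : (star ψ ⬝ᵥ (hubbardOpenBoxTT' a b 0 0 1 *ᵥ ψ)).re ≤ ED)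
    {t' U : ℝ} (hs₁ : s₁ ≤ t') (hs₂ : t' ≤ s₂) (hU₁' : U₁ ≤ U) (hU₂ : U ≤ U₂) :
    energyDensityTT' 1 t' U ((star ψ ⬝ᵥ (totalNumber *ᵥ ψ)).re / ((a : ℝ) * (b : ℝ))) ≤
      (EK + max (max (s₁ * EP) (s₂ * EP)) (max (-s₁ * EM) (-s₂ * EM)) + max (U₁ * ED) (U₂ * ED)) /
        ((a : ℝ) * (b : ℝ)) := by
  refine (energyDensityTT'_le_of_openBox_witness_planes_of_sectorProj_top_eq_zero (hU₁.trans hU₁') ha hb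
    hψ1 htop hK hP hM hD t').trans ?_
  have hab : (0 : ℝ) ≤ (a : ℝ) * (b : ℝ) := by positivity
  exact div_le_div_of_nonneg_right (witnessPlane_le_cornerMax hs₁ hs₂ hU₁' hU₂) hab

end ThermodynamicLimit

end Literature.MathematicalPhysics.QuantumLattice

end
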